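import Summits.QuantumFields.YangMills.Theorems.BalabanUVNodesN19SingleModeL1Norm
import Summits.QuantumFields.YangMills.Theorems.BalabanUVNodesN19TriangleWaveBessel
import Mathlib.NumberTheory.Harmonic.Bounds

/-!
# YM-DAG node N19 (= NE7 proper) — MULTISCALE TELESCOPING, PART 3: OSCILLATING LINKS OF THE ℓ¹-NORM — trigonometric-polynomial links by
# linearity, links with a trigonometric approximation, and the PERIODIC ZIGZAGS `dist(Σ_i|x_i|, Pℤ)` (the numerically extremal family of (v′))
# at `≲ d·log t·(log t + log N)∕t`

Cell `pub-ymgap`, HUMAN RULING D-0062 (Track A) ∕ D-0149 (work-bound push), R141 (C) wider-strategy seat `pub-ymgap-dag-n19-e` (strategy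
s3 = ALTERNATIVE CURRENCY), generation g30, module 3 (lineage module 120).  Route `Summits/QuantumFields/YangMills/Theses/BalabanUVNodes.lean`,
cluster item K3⁸ «SpineGivenEndpointR13SepCoPHV» (stmt-QuantumFields-27366); filed `--supports` that item `--as helper` (it proves no registered
stub).  COUNT-NEUTRAL: [folklore] approximation theory over Mathlib (`MvPolynomial.totalDegree`, `harmonic_le_one_add_log`) and the lineage BY NAME —
PART 2 `…N19SingleModeL1Norm` (`exists_mvPolynomial_near_cos_l1Norm` ∕ `…_sin_…`: the single mode of the ℓ¹-norm at `(J + 1 + 4ωd)∕2^J` for total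
degree `(J+1)(2^{J+2} + 150ωd)`; `abs_l1Norm_sub_half_le`) and module 85 `…N19TriangleWaveBessel` (`hasSum_odd_cos_div_sq_arccos_cos`: the odd cosine
series of the triangle wave `arccos∘cos`); no laws, no scheme object, no Theses import; NOT a discharge claim.

CONTEXT — (v′) OF CURRENCY-MAP v8, THE OSCILLATING REGIME.  PART 2 typed the single-mode law `dist_∞(e^{iωS_d}, Π_t) ≲ (ωd + log t)log t∕t`
(`S_d = Σ_{i≤d}|x_i|`, degree model).  This module synthesises LINKS from modes.  §1 ★ `exists_mvPolynomial_near_trigSum_l1Norm`: a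
trigonometric polynomial `c + Σ_{n<N}(a_n cos(ω_nS) + b_n sin(ω_nS))` (`0 ≤ ω_n ≤ Ω`) is within `Σ_n(|a_n| + |b_n|)(J + 1 + 4ω_n d)∕2^J` of an
`MvPolynomial` of total degree `≤ (J+1)(2^{J+2} + 150Ωd)` (linearity; one `J` for all modes).  §2 ★ `exists_mvPolynomial_near_link_of_trigApprox`:
a link `h` within `τ` of such a trigonometric polynomial on `[0, d]` costs `τ` more (`S_d ∈ [0, d]`).  §3 `sum_inv_oddSq_shift_le` ·
★ `abs_arccos_cos_sub_partialSum_le` (the triangle wave within `1∕(πN)` of its `N`-term odd cosine sum: tail `Σ_{i≥N}(2i+1)^{−2} ≤ 1∕(4N)` by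
telescoping).  §4 ★★ `exists_mvPolynomial_near_zigzag_l1Norm`: the PERIODIC ZIGZAG `h_P(s) = dist(s, Pℤ) = (P∕2π)·arccos(cos(2πs∕P))` composed with
`S_d` is within `P∕(2π²N) + (P(J+1)∕4 + (16d∕π)(1 + log N))∕2^J` of an `MvPolynomial` of total degree `≤ (J+1)(2^{J+2} + 600πNd∕P)`, for every
`P > 0`, `J`, `N ≥ 1` (§2 on the triangle-wave series; `Σ_{i<N}(2i+1)^{−2} ≤ π²∕8`, `Σ_{i<N}(2i+1)^{−1} ≤ H_N ≤ 1 + log N`); `abs_zigzag_sub_quarter_le`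
(`|h_P − P∕4| ≤ P∕4`: tiny periods need no polynomial).
READING for (v′) (honest).  At a degree budget `t ≍ (J+1)2^{J+3}` (`2^{−J} ≍ 8log₂t∕t`) with `N ≍ 2^J P∕(150πd)` modes retained: the zigzag links of
the ℓ¹-norm of `d` strings — the numerically EXTREMAL family of HOME `numerics/` (critical period `P ≈ 5d∕t`, supremum over links `= d ×` the
one-string value) — cost `≲ d·log t·(log t + log N)∕t ≲ d·log²t∕t` for EVERY period `P ≤ 2d` (periods below `≍ d log t∕t` by the constant `P∕4`),
against nesting's `≍ d∕√t` (module 111): the conjectured ridge rate `Θ(d∕t)` up to `log²`.  (v′) PROPER STAYS OPEN: a GENERAL 1-Lipschitz link has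
`Σ_{n≤t}|ĥ′(n)| ≲ √t` only (OPEN-PROBLEM.md dead-end «Fourier∕Esseen route»), so §2 gives it nothing better than `d∕√t`; what §2 covers at the ridge
rate up to logarithms is the class of links whose DERIVATIVE has an absolutely summable (or, as for zigzags, log-divergent lacunary-harmonic)
Fourier series on `[0, d]`.

HONEST FRAMING (binding).  Elementary and [folklore]; ONE-SIDED (upper bounds); NO consumer in the DAG today (an optimality map of the seat's own
currency, degree model); nothing of Bałaban's instantiated; NE7 NOT PRINTED, NOT proved; N19 NOT discharged; count-neutral.  One finite `T⁴` programme
at fixed `ε`; nothing continuum ∕ `ℝ⁴` ∕ OS ∕ mass-gap ∕ Clay.  0 `def` ∕ 0 `sorry`.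
-/

noncomputable section

open Finset
open scoped Real

namespace Summit.QuantumFields.YangMills.Theorems.BalabanUVNodesN19OscillatingLinksMultiscale

open Summit.QuantumFields.YangMills.Theorems.BalabanUVNodesN19SingleModeL1Norm
  (exists_mvPolynomial_near_cos_l1Norm exists_mvPolynomial_near_sin_l1Norm abs_l1Norm_sub_half_le)
open Summit.QuantumFields.YangMills.Theorems.BalabanUVNodesN19TriangleWaveBessel (hasSum_odd_cos_div_sq_arccos_cos)

variable {ι : Type*} [Fintype ι]

/-! ## §1 ★ Trigonometric-polynomial links by linearity [folklore] -/

/-- ★ **TRIGONOMETRIC-POLYNOMIAL LINKS OF THE ℓ¹-NORM.**  For frequencies `0 ≤ ω_n` with `ω_n ≤ Ω` for `n < N`, coefficients `a_n, b_n, c` and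
every `J` there is `P : MvPolynomial ι ℝ` of total degree `≤ (J+1)(2^{J+2} + 150Ωd)` with
`|c + Σ_{n<N}(a_n cos(ω_nS(x)) + b_n sin(ω_nS(x))) − P(x)| ≤ Σ_{n<N}(|a_n| + |b_n|)·(J + 1 + 4ω_n d)∕2^J` on `[−1,1]^ι` (`S(x) = Σ_i|x_i|`, `d = |ι|`):
PART 2's cos ∕ sin faces mode by mode, one `J` for all. [folklore] -/
theorem exists_mvPolynomial_near_trigSum_l1Norm (c : ℝ) (a b ω : ℕ → ℝ) (N : ℕ) {Ω : ℝ} (hΩ : 0 ≤ Ω)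
    (hω0 : ∀ n, 0 ≤ ω n) (hωΩ : ∀ n, n < N → ω n ≤ Ω) (J : ℕ) :
    ∃ P : MvPolynomial ι ℝ, (P.totalDegree : ℝ) ≤ ((J : ℝ) + 1) * (2 ^ (J + 2) + 150 * Ω * Fintype.card ι) ∧
      ∀ x : ι → ℝ, (∀ i, x i ∈ Set.Icc (-1 : ℝ) 1) →
        |(c + ∑ n ∈ range N, (a n * Real.cos (ω n * ∑ i, |x i|) + b n * Real.sin (ω n * ∑ i, |x i|))) -
            MvPolynomial.eval x P| ≤
          ∑ n ∈ range N, (|a n| + |b n|) * (((J : ℝ) + 1 + 4 * ω n * Fintype.card ι) / 2 ^ J) := by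
  classical
  set d : ℝ := (Fintype.card ι : ℝ) with hd
  have hd0 : 0 ≤ d := Nat.cast_nonneg _
  set X : ℝ := ((J : ℝ) + 1) * (2 ^ (J + 2) + 150 * Ω * d) with hX
  have hX0 : 0 ≤ X := by positivity
  choose Pc hPc_deg hPc_err using fun n => exists_mvPolynomial_near_cos_l1Norm (ι := ι) (hω0 n) J
  choose Ps hPs_deg hPs_err using fun n => exists_mvPolynomial_near_sin_l1Norm (ι := ι) (hω0 n) J
  set D : ℕ := ⌊X⌋₊ with hD
  have hXn : ∀ n, n < N → ((J : ℝ) + 1) * (2 ^ (J + 2) + 150 * ω n * d) ≤ X := by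
    intro n hn
    have : 150 * ω n * d ≤ 150 * Ω * d := by
      have := hωΩ n hn; nlinarith [hd0, hω0 n]
    have hJ0 : (0 : ℝ) ≤ (J : ℝ) + 1 := by positivity
    nlinarith
  have hdegc : ∀ n, n < N → (Pc n).totalDegree ≤ D := fun n hn => Nat.le_floor ((hPc_deg n).trans (hXn n hn))
  have hdegs : ∀ n, n < N → (Ps n).totalDegree ≤ D := fun n hn => Nat.le_floor ((hPs_deg n).trans (hXn n hn))
  refine ⟨MvPolynomial.C c + ∑ n ∈ range N, (MvPolynomial.C (a n) * Pc n + MvPolynomial.C (b n) * Ps n), ?_, ?_⟩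
  · have hnat : (MvPolynomial.C c + ∑ n ∈ range N, (MvPolynomial.C (a n) * Pc n + MvPolynomial.C (b n) * Ps n)).totalDegree ≤ D := by
      refine (MvPolynomial.totalDegree_add _ _).trans (max_le ?_ ?_)
      · rw [MvPolynomial.totalDegree_C]; exact Nat.zero_le _
      · refine MvPolynomial.totalDegree_finsetSum_le fun n hn => ?_
        have hn' : n < N := mem_range.1 hn
        refine (MvPolynomial.totalDegree_add _ _).trans (max_le ?_ ?_)
        · calc (MvPolynomial.C (a n) * Pc n).totalDegree ≤ (MvPolynomial.C (a n) : MvPolynomial ι ℝ).totalDegree + (Pc n).totalDegree :=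
              MvPolynomial.totalDegree_mul _ _
            _ ≤ 0 + D := by rw [MvPolynomial.totalDegree_C]; exact add_le_add le_rfl (hdegc n hn')
            _ = D := zero_add _
        · calc (MvPolynomial.C (b n) * Ps n).totalDegree ≤ (MvPolynomial.C (b n) : MvPolynomial ι ℝ).totalDegree + (Ps n).totalDegree :=
              MvPolynomial.totalDegree_mul _ _
            _ ≤ 0 + D := by rw [MvPolynomial.totalDegree_C]; exact add_le_add le_rfl (hdegs n hn')
            _ = D := zero_add _
    exact (Nat.cast_le.2 hnat).trans (Nat.floor_le hX0)
  · intro x hx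
    have hev : MvPolynomial.eval x (MvPolynomial.C c + ∑ n ∈ range N, (MvPolynomial.C (a n) * Pc n + MvPolynomial.C (b n) * Ps n)) =
        c + ∑ n ∈ range N, (a n * MvPolynomial.eval x (Pc n) + b n * MvPolynomial.eval x (Ps n)) := by
      rw [map_add, MvPolynomial.eval_C, map_sum]
      refine congrArg _ (Finset.sum_congr rfl fun n _ => ?_)
      rw [map_add, map_mul, map_mul, MvPolynomial.eval_C, MvPolynomial.eval_C]
    rw [hev, add_sub_add_left_eq_sub, ← Finset.sum_sub_distrib]
    refine (abs_sum_le_sum_abs _ _).trans (Finset.sum_le_sum fun n _ => ?_)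
    have e : a n * Real.cos (ω n * ∑ i, |x i|) + b n * Real.sin (ω n * ∑ i, |x i|) -
        (a n * MvPolynomial.eval x (Pc n) + b n * MvPolynomial.eval x (Ps n)) =
        a n * (Real.cos (ω n * ∑ i, |x i|) - MvPolynomial.eval x (Pc n)) +
          b n * (Real.sin (ω n * ∑ i, |x i|) - MvPolynomial.eval x (Ps n)) := by ring
    rw [e]
    calc |a n * (Real.cos (ω n * ∑ i, |x i|) - MvPolynomial.eval x (Pc n)) +
          b n * (Real.sin (ω n * ∑ i, |x i|) - MvPolynomial.eval x (Ps n))|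
        ≤ |a n * (Real.cos (ω n * ∑ i, |x i|) - MvPolynomial.eval x (Pc n))| +
          |b n * (Real.sin (ω n * ∑ i, |x i|) - MvPolynomial.eval x (Ps n))| := abs_add_le _ _
      _ ≤ |a n| * (((J : ℝ) + 1 + 4 * ω n * d) / 2 ^ J) + |b n| * (((J : ℝ) + 1 + 4 * ω n * d) / 2 ^ J) := by
          rw [abs_mul, abs_mul]
          exact add_le_add (mul_le_mul_of_nonneg_left (hPc_err n x hx) (abs_nonneg _))
            (mul_le_mul_of_nonneg_left (hPs_err n x hx) (abs_nonneg _))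
      _ = (|a n| + |b n|) * (((J : ℝ) + 1 + 4 * ω n * d) / 2 ^ J) := by ring

/-! ## §2 ★ Links with a trigonometric approximation [folklore] -/

/-- The ℓ¹-norm lies in `[0, d]` on the cube. [bookkeeping] -/
theorem l1Norm_mem_Icc (x : ι → ℝ) (hx : ∀ i, x i ∈ Set.Icc (-1 : ℝ) 1) :
    0 ≤ ∑ i, |x i| ∧ ∑ i, |x i| ≤ Fintype.card ι := by
  have h := abs_le.1 (abs_l1Norm_sub_half_le x hx)
  constructor <;> linarith [h.1, h.2]

/-- ★ **LINKS WITH A TRIGONOMETRIC APPROXIMATION.**  If `|h(s) − (c + Σ_{n<N}(a_n cos(ω_ns) + b_n sin(ω_ns)))| ≤ τ` for `s ∈ [0, d]`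
(`0 ≤ ω_n`, `ω_n ≤ Ω` for `n < N`), then for every `J` there is `P : MvPolynomial ι ℝ` of total degree `≤ (J+1)(2^{J+2} + 150Ωd)` with
`|h(Σ_i|x_i|) − P(x)| ≤ τ + Σ_{n<N}(|a_n| + |b_n|)(J + 1 + 4ω_n d)∕2^J` on `[−1,1]^ι`.  READING: at `t = (J+1)2^{J+3}`, `150Ωd ≤ 2^{J+2}`, a link with
`Σ_n(|a_n| + |b_n|)(1 + ω_n d) =: W < ∞` (absolutely summable DERIVATIVE series on `[0, d]`) costs `≲ τ_N + W·8log²₂t∕t` — the ridge rate up to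
`log²` for this Wiener-type class. [folklore] -/
theorem exists_mvPolynomial_near_link_of_trigApprox {h : ℝ → ℝ} (c : ℝ) (a b ω : ℕ → ℝ) (N : ℕ) {Ω τ : ℝ} (hΩ : 0 ≤ Ω)
    (hω0 : ∀ n, 0 ≤ ω n) (hωΩ : ∀ n, n < N → ω n ≤ Ω)
    (happrox : ∀ s : ℝ, 0 ≤ s → s ≤ Fintype.card ι →
      |h s - (c + ∑ n ∈ range N, (a n * Real.cos (ω n * s) + b n * Real.sin (ω n * s)))| ≤ τ) (J : ℕ) :
    ∃ P : MvPolynomial ι ℝ, (P.totalDegree : ℝ) ≤ ((J : ℝ) + 1) * (2 ^ (J + 2) + 150 * Ω * Fintype.card ι) ∧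
      ∀ x : ι → ℝ, (∀ i, x i ∈ Set.Icc (-1 : ℝ) 1) →
        |h (∑ i, |x i|) - MvPolynomial.eval x P| ≤
          τ + ∑ n ∈ range N, (|a n| + |b n|) * (((J : ℝ) + 1 + 4 * ω n * Fintype.card ι) / 2 ^ J) := by
  obtain ⟨P, hdeg, herr⟩ := exists_mvPolynomial_near_trigSum_l1Norm (ι := ι) c a b ω N hΩ hω0 hωΩ J
  refine ⟨P, hdeg, fun x hx => ?_⟩
  have hS := l1Norm_mem_Icc x hx
  exact (abs_sub_le _ _ _).trans (add_le_add (happrox _ hS.1 hS.2) (herr x hx))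

/-! ## §3 ★ The triangle wave and its truncated odd cosine series [folklore] -/

/-- `Σ_{i<n} 1∕(2(i+N)+1)² ≤ 1∕(4N) − 1∕(4(N+n))` for `N ≥ 1` (telescoping: `(2k+1)² ≥ 4k(k+1)`). [folklore] -/
theorem sum_inv_oddSq_shift_le {N : ℕ} (hN : 1 ≤ N) (n : ℕ) :
    ∑ i ∈ range n, 1 / (2 * ((i + N : ℕ) : ℝ) + 1) ^ 2 ≤ 1 / (4 * N) - 1 / (4 * ((N : ℝ) + n)) := by
  induction n with
  | zero => simp
  | succ n ih =>
    rw [Finset.sum_range_succ]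
    have hk : (1 : ℝ) ≤ (n + N : ℕ) := by exact_mod_cast le_add_left hN
    have hstep : 1 / (2 * ((n + N : ℕ) : ℝ) + 1) ^ 2 ≤ 1 / (4 * ((N : ℝ) + n)) - 1 / (4 * ((N : ℝ) + (n + 1 : ℕ))) := by
      have e : ((n + N : ℕ) : ℝ) = (N : ℝ) + n := by push_cast; ring
      rw [e] at hk ⊢
      push_cast
      rw [div_sub_div _ _ (by positivity) (by positivity), div_le_div_iff₀ (by positivity) (by positivity)]
      nlinarith
    push_cast at ih hstep ⊢
    linarith

/-- ★ **THE TRIANGLE WAVE WITHIN `1∕(πN)` OF ITS `N`-TERM ODD COSINE SUM.**  For every real `u` and `N ≥ 1`: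
`|arccos(cos u) − (π∕2 − (4∕π)Σ_{i<N} cos((2i+1)u)∕(2i+1)²)| ≤ 1∕(πN)` (module 85's series; tail `(4∕π)Σ_{i≥N}(2i+1)^{−2} ≤ (4∕π)·1∕(4N)`).
(`arccos∘cos` is the distance to `2πℤ`.) [folklore] -/
theorem abs_arccos_cos_sub_partialSum_le (u : ℝ) {N : ℕ} (hN : 1 ≤ N) :
    |Real.arccos (Real.cos u) - (π / 2 - 4 / π * ∑ i ∈ range N, Real.cos ((2 * i + 1) * u) / (2 * i + 1) ^ 2)| ≤ 1 / (π * N) := by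
  set f : ℕ → ℝ := fun i => Real.cos ((2 * i + 1) * u) / (2 * i + 1) ^ 2 with hf
  have hsum : HasSum f (π ^ 2 / 8 - π / 4 * Real.arccos (Real.cos u)) := hasSum_odd_cos_div_sq_arccos_cos u
  -- the tail
  have htail : HasSum (fun i => f (i + N)) (π ^ 2 / 8 - π / 4 * Real.arccos (Real.cos u) - ∑ i ∈ range N, f i) :=
    (hasSum_nat_add_iff' N).2 hsum
  set g : ℕ → ℝ := fun i => 1 / (2 * ((i + N : ℕ) : ℝ) + 1) ^ 2 with hg
  have hg0 : ∀ i, 0 ≤ g i := fun i => by positivity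
  have hgsum : ∀ n, ∑ i ∈ range n, g i ≤ 1 / (4 * N) := fun n =>
    (sum_inv_oddSq_shift_le hN n).trans (sub_le_self _ (by positivity))
  have hgS : Summable g := summable_of_sum_range_le hg0 hgsum
  have hgT : ∑' i, g i ≤ 1 / (4 * N) := Real.tsum_le_of_sum_range_le hg0 hgsum
  have hfg : ∀ i, |f (i + N)| ≤ g i := by
    intro i
    simp only [hf, hg, abs_div]
    push_cast
    have hden : (0 : ℝ) < (2 * ((i : ℝ) + N) + 1) ^ 2 := by positivity
    rw [abs_of_pos hden, div_le_div_iff_of_pos_right hden]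
    exact Real.abs_cos_le_one _
  have hup : π ^ 2 / 8 - π / 4 * Real.arccos (Real.cos u) - ∑ i ∈ range N, f i ≤ ∑' i, g i :=
    hasSum_le (fun i => (le_abs_self _).trans (hfg i)) htail hgS.hasSum
  have hlow : -(∑' i, g i) ≤ π ^ 2 / 8 - π / 4 * Real.arccos (Real.cos u) - ∑ i ∈ range N, f i := by
    have := hasSum_le (fun i => (neg_le.2 ((neg_le_abs _).trans (hfg i)) : -g i ≤ f (i + N))) hgS.hasSum.neg htail
    simpa using this
  -- rearrange
  have e : Real.arccos (Real.cos u) - (π / 2 - 4 / π * ∑ i ∈ range N, f i) =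
      -(4 / π) * (π ^ 2 / 8 - π / 4 * Real.arccos (Real.cos u) - ∑ i ∈ range N, f i) := by
    field_simp
    ring
  rw [e, abs_mul, abs_neg, abs_of_pos (by positivity : (0 : ℝ) < 4 / π)]
  have habs : |π ^ 2 / 8 - π / 4 * Real.arccos (Real.cos u) - ∑ i ∈ range N, f i| ≤ (1 : ℝ) / (4 * N) :=
    abs_le.2 ⟨by linarith, hup.trans hgT⟩
  calc 4 / π * |π ^ 2 / 8 - π / 4 * Real.arccos (Real.cos u) - ∑ i ∈ range N, f i| ≤ 4 / π * ((1 : ℝ) / (4 * N)) :=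
        mul_le_mul_of_nonneg_left habs (by positivity)
    _ = 1 / (π * N) := by field_simp

/-- `Σ_{i<N} 1∕(2i+1)² ≤ π²∕8` (a partial sum of the series at `u = 0`). [folklore] -/
theorem sum_inv_oddSq_le (N : ℕ) : ∑ i ∈ range N, 1 / (2 * (i : ℝ) + 1) ^ 2 ≤ π ^ 2 / 8 := by
  have h := hasSum_odd_cos_div_sq_arccos_cos 0
  rw [Real.cos_zero, Real.arccos_one, mul_zero, sub_zero] at h
  have e : (fun i : ℕ => Real.cos ((2 * i + 1) * (0 : ℝ)) / (2 * i + 1) ^ 2) = fun i : ℕ => 1 / (2 * (i : ℝ) + 1) ^ 2 := by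
    funext i; rw [mul_zero, Real.cos_zero]
  rw [e] at h
  exact sum_le_hasSum (range N) (fun i _ => by positivity) h

/-- `Σ_{i<N} 1∕(2i+1) ≤ 1 + log N` (`≤ H_N`, Mathlib's `harmonic_le_one_add_log`; `log 0 = 0`). [folklore] -/
theorem sum_inv_odd_le (N : ℕ) : ∑ i ∈ range N, 1 / (2 * (i : ℝ) + 1) ≤ 1 + Real.log N := by
  have h1 : ∑ i ∈ range N, 1 / (2 * (i : ℝ) + 1) ≤ ∑ i ∈ range N, ((i + 1 : ℕ) : ℝ)⁻¹ := by
    refine Finset.sum_le_sum fun i _ => ?_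
    rw [one_div]; push_cast
    exact inv_anti₀ (by positivity) (by linarith [(Nat.cast_nonneg i : (0 : ℝ) ≤ i)])
  have h2 : ((harmonic N : ℚ) : ℝ) = ∑ i ∈ range N, ((i + 1 : ℕ) : ℝ)⁻¹ := by
    simp only [harmonic, Rat.cast_sum, Rat.cast_inv, Rat.cast_natCast]
  have h3 := harmonic_le_one_add_log N
  rw [h2] at h3
  exact h1.trans h3

/-! ## §4 ★★ The periodic zigzags of the ℓ¹-norm [folklore] -/

/-- **TINY PERIODS NEED NO POLYNOMIAL.**  `|(P∕2π)·arccos(cos(2πs∕P)) − P∕4| ≤ P∕4` (`h_P = dist(·, Pℤ) ∈ [0, P∕2]`). [bookkeeping] -/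
theorem abs_zigzag_sub_quarter_le {P : ℝ} (hP : 0 < P) (s : ℝ) :
    |P / (2 * π) * Real.arccos (Real.cos (2 * π * s / P)) - P / 4| ≤ P / 4 := by
  have h0 := Real.arccos_nonneg (Real.cos (2 * π * s / P))
  have h1 := Real.arccos_le_pi (Real.cos (2 * π * s / P))
  have hc : 0 < P / (2 * π) := by positivity
  rw [abs_le]
  constructor
  · nlinarith [mul_nonneg hc.le h0]
  · have : P / (2 * π) * Real.arccos (Real.cos (2 * π * s / P)) ≤ P / (2 * π) * π := mul_le_mul_of_nonneg_left h1 hc.le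
    have e : P / (2 * π) * π = P / 2 := by field_simp
    linarith

/-- ★★ **THE PERIODIC ZIGZAGS OF THE ℓ¹-NORM.**  For `P > 0`, every `J` and `N ≥ 1` there is `Q : MvPolynomial ι ℝ` of total degree
`≤ (J+1)(2^{J+2} + 150·(4πN∕P)·d)` with, on `[−1,1]^ι` (`S(x) = Σ_i|x_i|`, `d = |ι|`),
  `|(P∕2π)·arccos(cos(2πS(x)∕P)) − Q(x)| ≤ P∕(2π²N) + (P(J+1)∕4 + (16d∕π)(1 + log N))∕2^J`
— the zigzag `h_P∘S = dist(S, Pℤ)`: §2 on the `N`-term triangle-wave series (§3; coefficients `2P∕(π²(2i+1)²)`, frequencies `2π(2i+1)∕P ≤ 4πN∕P`),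
then `Σ_{i<N}(2i+1)^{−2} ≤ π²∕8` and `Σ_{i<N}(2i+1)^{−1} ≤ 1 + log N`.  READING: `2^J ≍ t∕(8log₂t)`, `N ≍ 2^J P∕(150πd)`: for every period
`d·log t∕t ≲ P ≤ 2d` the zigzag link costs `≲ d·log t·(log t + log N)∕t ≲ d·log²t∕t` at total degree `t` (smaller periods: the constant `P∕4`,
`abs_zigzag_sub_quarter_le`) — the conjectured ridge rate up to `log²` for the numerically extremal family of (v′). [folklore] -/
theorem exists_mvPolynomial_near_zigzag_l1Norm {P : ℝ} (hP : 0 < P) (J : ℕ) {N : ℕ} (hN : 1 ≤ N) :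
    ∃ Q : MvPolynomial ι ℝ,
      (Q.totalDegree : ℝ) ≤ ((J : ℝ) + 1) * (2 ^ (J + 2) + 150 * (4 * π * N / P) * Fintype.card ι) ∧
      ∀ x : ι → ℝ, (∀ i, x i ∈ Set.Icc (-1 : ℝ) 1) →
        |P / (2 * π) * Real.arccos (Real.cos (2 * π * (∑ i, |x i|) / P)) - MvPolynomial.eval x Q| ≤
          P / (2 * π ^ 2 * N) + (P * ((J : ℝ) + 1) / 4 + 16 * Fintype.card ι / π * (1 + Real.log N)) / 2 ^ J := by
  set d : ℝ := (Fintype.card ι : ℝ) with hd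
  have hd0 : 0 ≤ d := Nat.cast_nonneg _
  have hπ := Real.pi_pos
  -- data of the trigonometric approximation
  set a : ℕ → ℝ := fun i => -(2 * P / (π ^ 2 * (2 * (i : ℝ) + 1) ^ 2)) with ha
  set ω : ℕ → ℝ := fun i => 2 * π * (2 * (i : ℝ) + 1) / P with hω
  have hω0 : ∀ i, 0 ≤ ω i := fun i => by positivity
  have hωΩ : ∀ i, i < N → ω i ≤ 4 * π * N / P := by
    intro i hi
    simp only [hω]
    rw [div_le_div_iff_of_pos_right hP]
    have : (i : ℝ) + 1 ≤ N := by exact_mod_cast hi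
    nlinarith
  have hΩ : 0 ≤ 4 * π * N / P := by positivity
  -- the truncation bound on `[0, d]` (indeed everywhere)
  have happrox : ∀ s : ℝ, 0 ≤ s → s ≤ Fintype.card ι →
      |P / (2 * π) * Real.arccos (Real.cos (2 * π * s / P)) -
          (P / 4 + ∑ i ∈ range N, (a i * Real.cos (ω i * s) + (0 : ℝ) * Real.sin (ω i * s)))| ≤ P / (2 * π ^ 2 * N) := by
    intro s _ _
    have h := abs_arccos_cos_sub_partialSum_le (2 * π * s / P) hN
    have e : P / (2 * π) * Real.arccos (Real.cos (2 * π * s / P)) -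
          (P / 4 + ∑ i ∈ range N, (a i * Real.cos (ω i * s) + (0 : ℝ) * Real.sin (ω i * s))) =
        P / (2 * π) * (Real.arccos (Real.cos (2 * π * s / P)) -
          (π / 2 - 4 / π * ∑ i ∈ range N, Real.cos ((2 * i + 1) * (2 * π * s / P)) / (2 * i + 1) ^ 2)) := by
      have hterm : ∀ i ∈ range N, a i * Real.cos (ω i * s) + (0 : ℝ) * Real.sin (ω i * s) =
          -(P / (2 * π) * (4 / π * (Real.cos ((2 * i + 1) * (2 * π * s / P)) / (2 * i + 1) ^ 2))) := by
        intro i _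
        have eω : ω i * s = (2 * i + 1) * (2 * π * s / P) := by simp only [hω]; field_simp
        rw [zero_mul, add_zero, eω]
        simp only [ha]
        field_simp
        ring
      rw [Finset.sum_congr rfl hterm, Finset.sum_neg_distrib, ← Finset.mul_sum, ← Finset.mul_sum]
      field_simp
      ring
    rw [e, abs_mul, abs_of_pos (by positivity : (0 : ℝ) < P / (2 * π))]
    calc P / (2 * π) * |_| ≤ P / (2 * π) * (1 / (π * N)) := mul_le_mul_of_nonneg_left h (by positivity)
      _ = P / (2 * π ^ 2 * N) := by field_simp
  obtain ⟨Q, hdeg, herr⟩ := exists_mvPolynomial_near_link_of_trigApprox (ι := ι)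
    (h := fun s => P / (2 * π) * Real.arccos (Real.cos (2 * π * s / P))) (P / 4) a (fun _ => 0) ω N hΩ hω0 hωΩ happrox J
  refine ⟨Q, hdeg, fun x hx => (herr x hx).trans (add_le_add le_rfl ?_)⟩
  -- the coefficient sum
  have h2J : (0 : ℝ) < 2 ^ J := by positivity
  have hterm : ∀ i ∈ range N, (|a i| + |(0 : ℝ)|) * (((J : ℝ) + 1 + 4 * ω i * Fintype.card ι) / 2 ^ J) =
      ((2 * P / π ^ 2 * ((J : ℝ) + 1)) * (1 / (2 * (i : ℝ) + 1) ^ 2) + (16 * d / π) * (1 / (2 * (i : ℝ) + 1))) / 2 ^ J := by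
    intro i _
    have hi : (0 : ℝ) < 2 * (i : ℝ) + 1 := by positivity
    simp only [ha, hω, abs_zero, add_zero, abs_neg]
    rw [abs_of_pos (by positivity)]
    field_simp
    ring
  rw [Finset.sum_congr rfl hterm, ← Finset.sum_div, Finset.sum_add_distrib, ← Finset.mul_sum, ← Finset.mul_sum,
    div_le_div_iff_of_pos_right h2J]
  have hs1 := sum_inv_oddSq_le N
  have hs2 := sum_inv_odd_le N
  have hA : 0 ≤ 2 * P / π ^ 2 * ((J : ℝ) + 1) := by positivity
  have hB : 0 ≤ 16 * d / π := by positivity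
  calc 2 * P / π ^ 2 * ((J : ℝ) + 1) * ∑ i ∈ range N, 1 / (2 * (i : ℝ) + 1) ^ 2 + 16 * d / π * ∑ i ∈ range N, 1 / (2 * (i : ℝ) + 1)
      ≤ 2 * P / π ^ 2 * ((J : ℝ) + 1) * (π ^ 2 / 8) + 16 * d / π * (1 + Real.log N) :=
        add_le_add (mul_le_mul_of_nonneg_left hs1 hA) (mul_le_mul_of_nonneg_left hs2 hB)
    _ = P * ((J : ℝ) + 1) / 4 + 16 * d / π * (1 + Real.log N) := by field_simp; ring

end Summit.QuantumFields.YangMills.Theorems.BalabanUVNodesN19OscillatingLinksMultiscale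

end
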